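import Literature.Geometry.Lorentzian.BilinPullbackEstimates
import HarnessLib

/-!
# Fields of bilinear forms read in a moving frame: `Cᵏ` estimates and continuity

For a field of continuous bilinear forms `F : E → (E →L E →L ℝ)` and a FRAME FIELD
`M : E → (E →L E)` the **framed field** is `framedBilin F M y (v, w) = F(y)(M(y) v, M(y) w)`
(`= (F y).bilinearComp (M y) (M y)`; the coordinate pullback `bilinPullback θ B` of
`BilinPullbackEstimates.lean` is the case `F = B ∘ θ`, `M = Dθ`). We prove the linear `Cᵏ` estimate
`‖Dᵐ(framedBilin F M)(x)‖ ≤ 4ᵏ Θ² N` from bounds `‖Dʲ M(x)‖ ≤ Θ` (`Θ ≥ 1`) and `‖Dʲ F(x)‖ ≤ N`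
(`j ≤ k`; two Leibniz rules, no Faà di Bruno), and its consequence: **reading in a fixed smooth
frame is continuous for `Cᵏ_loc` convergence to zero** (`tendsto_supCkENorm_framedBilin`). Used to
state tameness relative to a FRAMED background (`G = framedBilin (η + h) A`, e.g. Kerr in the
Kerr–Schild frame) and to transport the `C^∞_loc` convergence of framed deviations back to the
metric components (`NearFramedChart.lean`, `TameChartCompactnessFramed.lean`).

## References
* P. Petersen, *Riemannian Geometry*, 2nd ed., GTM 171, Springer 2006, Ch. 10, §3.2 (convergence of
  tensors is independent of the frames used). [Petersen2006]
-/

noncomputable section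

open Set Filter Topology Function
open scoped ENNReal Nat

namespace Literature.Geometry.Lorentzian

section Framed

variable {E : Type*} [NormedAddCommGroup E] [NormedSpace ℝ E]

/-- **A field of bilinear forms read in a frame field**: `framedBilin F M y (v, w) = F y (M y v) (M y w)`.
[cite: Petersen2006, Ch. 10 §3.2] -/
def framedBilin (F : E → E →L[ℝ] E →L[ℝ] ℝ) (M : E → E →L[ℝ] E) : E → E →L[ℝ] E →L[ℝ] ℝ :=
  fun y ↦ (ContinuousLinearMap.precomp ℝ (M y)).comp ((F y).comp (M y))

/-- Unfolding lemma. [folklore] -/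
@[simp]
theorem framedBilin_apply (F : E → E →L[ℝ] E →L[ℝ] ℝ) (M : E → E →L[ℝ] E) (y v w : E) :
    framedBilin F M y v w = F y (M y v) (M y w) := rfl

/-- `framedBilin` is additive in the field. [folklore] -/
theorem framedBilin_sub (F₁ F₂ : E → E →L[ℝ] E →L[ℝ] ℝ) (M : E → E →L[ℝ] E) :
    framedBilin (F₁ - F₂) M = framedBilin F₁ M - framedBilin F₂ M := by
  funext y; ext v w; simp [framedBilin_apply]

/-- `framedBilin` is additive in the field (sum). [folklore] -/
theorem framedBilin_add (F₁ F₂ : E → E →L[ℝ] E →L[ℝ] ℝ) (M : E → E →L[ℝ] E) :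
    framedBilin (F₁ + F₂) M = framedBilin F₁ M + framedBilin F₂ M := by
  funext y; ext v w; simp [framedBilin_apply]

/-- Pointwise form of `framedBilin_sub`. [folklore] -/
theorem framedBilin_sub_apply (F₁ F₂ : E → E →L[ℝ] E →L[ℝ] ℝ) (M : E → E →L[ℝ] E) (y : E) :
    framedBilin (F₁ - F₂) M y = framedBilin F₁ M y - framedBilin F₂ M y := by
  rw [framedBilin_sub]; rfl

/-- **Unframing**: reading in `Minv` and then in `M` with `Minv y ∘ M y = id` gives back the field.
[folklore] -/
theorem framedBilin_framedBilin_of_comp_eq (F : E → E →L[ℝ] E →L[ℝ] ℝ) {M Minv : E → E →L[ℝ] E}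
    {y : E} (h : (Minv y).comp (M y) = ContinuousLinearMap.id ℝ E) :
    framedBilin (framedBilin F Minv) M y = F y := by
  ext v w
  have hv : Minv y (M y v) = v := by simpa using DFunLike.congr_fun h v
  have hw : Minv y (M y w) = w := by simpa using DFunLike.congr_fun h w
  simp [framedBilin_apply, hv, hw]

/-- The framed field is symmetric if the field is. [folklore] -/
theorem framedBilin_symm {F : E → E →L[ℝ] E →L[ℝ] ℝ} (M : E → E →L[ℝ] E) {y : E}
    (h : ∀ v w, F y v w = F y w v) (v w : E) : framedBilin F M y v w = framedBilin F M y w v := by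
  simp [framedBilin_apply, h]

/-- Smoothness of the framed field. [folklore] -/
theorem ContDiffOn.framedBilin {F : E → E →L[ℝ] E →L[ℝ] ℝ} {M : E → E →L[ℝ] E} {s : Set E}
    {n : ℕ∞} (hF : ContDiffOn ℝ n F s) (hM : ContDiffOn ℝ n M s) :
    ContDiffOn ℝ n (framedBilin F M) s := by
  have hQ : ContDiffOn ℝ n (fun y ↦ (F y).comp (M y)) s := hF.clm_comp hM
  have hP : ContDiffOn ℝ n (fun y ↦ ContinuousLinearMap.precomp ℝ (M y) :
      E → (E →L[ℝ] ℝ) →L[ℝ] E →L[ℝ] ℝ) s := by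
    have hPeq : (fun y ↦ (ContinuousLinearMap.precomp ℝ (M y) : (E →L[ℝ] ℝ) →L[ℝ] E →L[ℝ] ℝ)) =
        (ContinuousLinearMap.compL ℝ E E ℝ).flip ∘ M := by
      funext y; exact precomp_eq_flip_compL _
    rw [hPeq]
    exact (ContinuousLinearMap.contDiff _).comp_contDiffOn hM
  exact hP.clm_comp hQ

/-- **The linear `Cᵏ` estimate for framed fields**: from `‖Dʲ M(x)‖ ≤ Θ` (`Θ ≥ 1`) and
`‖Dʲ F(x)‖ ≤ N` (`N ≥ 0`) for `j ≤ k`, `‖Dᵐ(framedBilin F M)(x)‖ ≤ 4ᵏ Θ² N` for `m ≤ k`.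
[folklore] -/
theorem norm_iteratedFDeriv_framedBilin_le {F : E → E →L[ℝ] E →L[ℝ] ℝ} {M : E → E →L[ℝ] E}
    {s : Set E} (hs : IsOpen s) {k : ℕ} (hF : ContDiffOn ℝ k F s) (hM : ContDiffOn ℝ k M s)
    {x : E} (hx : x ∈ s) {Θ N : ℝ} (hΘ₁ : 1 ≤ Θ) (hN : 0 ≤ N)
    (hMb : ∀ j, j ≤ k → ‖iteratedFDeriv ℝ j M x‖ ≤ Θ)
    (hFb : ∀ j, j ≤ k → ‖iteratedFDeriv ℝ j F x‖ ≤ N) {m : ℕ} (hm : m ≤ k) :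
    ‖iteratedFDeriv ℝ m (framedBilin F M) x‖ ≤ 4 ^ k * Θ ^ 2 * N := by
  set Q : E → E →L[ℝ] E →L[ℝ] ℝ := fun y ↦ (F y).comp (M y) with hQdef
  set P : E → (E →L[ℝ] ℝ) →L[ℝ] E →L[ℝ] ℝ := fun y ↦ ContinuousLinearMap.precomp ℝ (M y)
    with hPdef
  have hΘ₀ : 0 ≤ Θ := zero_le_one.trans hΘ₁
  have hQ : ContDiffOn ℝ k Q s := hF.clm_comp hM
  have hPeq : P = (ContinuousLinearMap.compL ℝ E E ℝ).flip ∘ M := by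
    funext y
    exact precomp_eq_flip_compL _
  have hP : ContDiffOn ℝ k P s := by
    rw [hPeq]
    exact (ContinuousLinearMap.contDiff _).comp_contDiffOn hM
  -- Leibniz for `Q`
  have hQb : ∀ b, b ≤ k → ‖iteratedFDeriv ℝ b Q x‖ ≤ 2 ^ k * Θ * N := by
    intro b hb
    refine (norm_iteratedFDeriv_clm_comp_le (P := F) (Q := M) hs hF hM hx hb).trans ?_
    have hterm : ∀ i ∈ Finset.range (b + 1),
        (b.choose i : ℝ) * ‖iteratedFDeriv ℝ i F x‖ * ‖iteratedFDeriv ℝ (b - i) M x‖ ≤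
        (b.choose i : ℝ) * (N * Θ) := by
      intro i hi
      have hi' : i ≤ b := Nat.lt_succ_iff.mp (Finset.mem_range.mp hi)
      rw [mul_assoc]
      refine mul_le_mul_of_nonneg_left ?_ (by positivity)
      exact mul_le_mul (hFb i (hi'.trans hb)) (hMb (b - i) (by omega)) (norm_nonneg _) hN
    refine (Finset.sum_le_sum hterm).trans ?_
    rw [← Finset.sum_mul, sum_range_choose_real]
    have h2 : (2 : ℝ) ^ b ≤ 2 ^ k := pow_le_pow_right₀ (by norm_num) hb
    calc (2 : ℝ) ^ b * (N * Θ) ≤ 2 ^ k * (N * Θ) := by gcongr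
      _ = 2 ^ k * Θ * N := by ring
  -- the outer factor
  have hPb : ∀ a, a ≤ k → ‖iteratedFDeriv ℝ a P x‖ ≤ Θ := by
    intro a ha
    rw [hPeq, ← iteratedFDerivWithin_of_isOpen a hs hx,
      ContinuousLinearMap.iteratedFDerivWithin_comp_left _ ((hM x hx).of_le le_rfl)
        hs.uniqueDiffOn hx (by exact_mod_cast ha)]
    refine (ContinuousLinearMap.norm_compContinuousMultilinearMap_le _ _).trans ?_
    have hA : ‖(ContinuousLinearMap.compL ℝ E E ℝ).flip‖ ≤ 1 := by
      rw [ContinuousLinearMap.opNorm_flip]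
      exact ContinuousLinearMap.norm_compL_le _ _ _ _
    rw [iteratedFDerivWithin_of_isOpen a hs hx]
    calc ‖(ContinuousLinearMap.compL ℝ E E ℝ).flip‖ * ‖iteratedFDeriv ℝ a M x‖
        ≤ 1 * Θ := mul_le_mul hA (hMb a ha) (norm_nonneg _) zero_le_one
      _ = Θ := one_mul Θ
  -- Leibniz for `framedBilin = P.comp Q`
  have hfun : framedBilin F M = fun y ↦ (P y).comp (Q y) := rfl
  rw [hfun]
  refine (norm_iteratedFDeriv_clm_comp_le hs hP hQ hx hm).trans ?_
  have hterm : ∀ i ∈ Finset.range (m + 1),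
      (m.choose i : ℝ) * ‖iteratedFDeriv ℝ i P x‖ * ‖iteratedFDeriv ℝ (m - i) Q x‖ ≤
      (m.choose i : ℝ) * (Θ * (2 ^ k * Θ * N)) := by
    intro i hi
    have hi' : i ≤ m := Nat.lt_succ_iff.mp (Finset.mem_range.mp hi)
    rw [mul_assoc]
    refine mul_le_mul_of_nonneg_left ?_ (by positivity)
    exact mul_le_mul (hPb i (hi'.trans hm)) (hQb (m - i) (by omega)) (norm_nonneg _) hΘ₀
  refine (Finset.sum_le_sum hterm).trans ?_
  rw [← Finset.sum_mul, sum_range_choose_real]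
  have h2 : (2 : ℝ) ^ m ≤ 2 ^ k := pow_le_pow_right₀ (by norm_num) hm
  have h4 : (4 : ℝ) ^ k = 2 ^ k * 2 ^ k := by
    rw [← mul_pow]; norm_num
  calc (2 : ℝ) ^ m * (Θ * (2 ^ k * Θ * N)) = 2 ^ m * (2 ^ k * Θ ^ 2 * N) := by ring
    _ ≤ 2 ^ k * (2 ^ k * Θ ^ 2 * N) := by gcongr
    _ = 4 ^ k * Θ ^ 2 * N := by rw [h4]; ring

/-- A `Cᵏ` map on an open set has all derivatives of orders `≤ k` bounded by a common constant
`Θ ≥ 1` on any compact subset. [folklore] -/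
theorem exists_bound_iteratedFDeriv_le_of_isCompact {G : Type*} [NormedAddCommGroup G]
    [NormedSpace ℝ G] {M : E → G} {s : Set E} (hs : IsOpen s) {k : ℕ} (hM : ContDiffOn ℝ k M s)
    {K : Set E} (hK : IsCompact K) (hKs : K ⊆ s) :
    ∃ Θ : ℝ, 1 ≤ Θ ∧ ∀ i, i ≤ k → ∀ x ∈ K, ‖iteratedFDeriv ℝ i M x‖ ≤ Θ := by
  have hcont : ∀ i, i ≤ k → ContinuousOn (iteratedFDeriv ℝ i M) K := by
    intro i hi
    have h1 : ContinuousOn (iteratedFDerivWithin ℝ i M s) s :=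
      hM.continuousOn_iteratedFDerivWithin (by exact_mod_cast hi) hs.uniqueDiffOn
    exact (h1.congr fun y hy ↦ (iteratedFDerivWithin_of_isOpen i hs hy).symm).mono hKs
  choose! C hC using fun i (hi : i ≤ k) ↦ hK.exists_bound_of_continuousOn (hcont i hi)
  refine ⟨max 1 (∑ i ∈ Finset.range (k + 1), |C i|), le_max_left _ _, fun i hi x hx ↦ ?_⟩
  refine ((hC i hi x hx).trans (le_abs_self _)).trans ((Finset.single_le_sum
    (f := fun i ↦ |C i|) (fun j _ ↦ abs_nonneg (C j))
    (Finset.mem_range.mpr (by omega))).trans (le_max_right _ _))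

/-- **Reading in a fixed smooth frame is continuous for `Cᵏ_loc` convergence to zero**: if `M`
is `Cᵏ` on an open `s ⊇ K`, `K` compact, and the fields `F i` are eventually `Cᵏ` on open
neighbourhoods of `K` with `supCkENorm K k (F i) → 0`, then `supCkENorm K k (framedBilin (F i) M) → 0`.
[cite: Petersen2006, Ch. 10 §3.2] -/
theorem tendsto_supCkENorm_framedBilin {ι : Type*} {l : Filter ι} {M : E → E →L[ℝ] E} {s : Set E}
    (hs : IsOpen s) {k : ℕ} (hM : ContDiffOn ℝ k M s) {K : Set E} (hK : IsCompact K) (hKs : K ⊆ s)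
    {F : ι → E → E →L[ℝ] E →L[ℝ] ℝ}
    (hF : ∀ᶠ i in l, ∃ t : Set E, IsOpen t ∧ K ⊆ t ∧ ContDiffOn ℝ k (F i) t)
    (hlim : Tendsto (fun i ↦ supCkENorm K k (F i)) l (𝓝 0)) :
    Tendsto (fun i ↦ supCkENorm K k (framedBilin (F i) M)) l (𝓝 0) := by
  obtain ⟨Θ, hΘ₁, hΘ⟩ := exists_bound_iteratedFDeriv_le_of_isCompact hs hM hK hKs
  set A : ℝ := 4 ^ k * Θ ^ 2 with hA
  have hfin : ∀ᶠ i in l, supCkENorm K k (F i) < 1 := (tendsto_order.1 hlim).2 1 zero_lt_one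
  have hN : Tendsto (fun i ↦ (supCkENorm K k (F i)).toReal) l (𝓝 0) := by
    have h := (ENNReal.tendsto_toReal ENNReal.zero_ne_top).comp hlim
    rw [ENNReal.toReal_zero] at h
    exact h
  have hupper : Tendsto (fun i ↦ ENNReal.ofReal (A * (supCkENorm K k (F i)).toReal)) l (𝓝 0) := by
    have h := ENNReal.tendsto_ofReal (hN.const_mul A)
    simpa using h
  refine tendsto_of_tendsto_of_tendsto_of_le_of_le' tendsto_const_nhds hupper
    (Eventually.of_forall fun _ ↦ zero_le) ?_
  filter_upwards [hF, hfin] with i hFi hfi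
  obtain ⟨t, ht, hKt, hFt⟩ := hFi
  set s' : Set E := s ∩ t with hs'
  have hs'o : IsOpen s' := hs.inter ht
  have hKs' : K ⊆ s' := fun x hx ↦ ⟨hKs hx, hKt hx⟩
  have hfin' : supCkENorm K k (F i) ≠ ⊤ := (hfi.trans ENNReal.one_lt_top).ne
  refine supCkENorm_le_ofReal fun m hm x hx ↦ ?_
  exact norm_iteratedFDeriv_framedBilin_le hs'o (hFt.mono inter_subset_right)
    (hM.mono inter_subset_left) (hKs' hx) hΘ₁ ENNReal.toReal_nonneg (fun j hj ↦ hΘ j hj x hx)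
    (fun j hj ↦ norm_iteratedFDeriv_le_toReal_supCkENorm hj hx _ hfin') hm

end Framed

end Literature.Geometry.Lorentzian

end
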